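import Mathlib
import HarnessLib

/-!
# Weighted Lyapunov inequality between a positive and a negative fractional moment

Monotonicity of power means (Lyapunov's inequality, Hardy–Littlewood–Pólya *Inequalities*, Thm 16:
`M_{-r}(Y) ≤ M_s(Y)` for `-r < 0 < s`) in the weighted, junk-free `ℝ≥0∞` form in which it converts
an UPPER bound on a negative moment `∫ w Y^{-r} dμ` into a LOWER bound on a positive fractional
moment `∫ w Y^s dμ` of a non-negative observable `Y` under a weight `w ≥ 0`:

* `lintegral_le_rpow_lintegral_mul_rpow_lintegral` — Hölder with the conjugate pair
  `(r/(r+s), s/(r+s))`: `∫⁻ w ≤ (∫⁻ w Y^s)^{r/(r+s)} (∫⁻ w Y^{-r})^{s/(r+s)}` as soon as the negative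
  moment is finite (which forces `w = 0` a.e. on `{Y = 0}`, where `Y^{-r} = ⊤`);
* `lintegral_le_rpow_mul_lintegral_of_lintegral_rpow_neg_le` — if `∫⁻ w Y^{-r} ≤ B ∫⁻ w` with
  `0 < ∫⁻ w < ∞`, `B < ∞`, then `∫⁻ w ≤ B^{s/r} ∫⁻ w Y^s`;
* `rpow_neg_mul_integral_le_integral_mul_rpow` — the same for real-valued `w, X ≥ 0` with Bochner
  integrals on the positive side: `B^{-s/r} ∫ w dμ ≤ ∫ w X^s dμ`.

Proof: pointwise `w = (w Y^s)^{r/(r+s)} (w Y^{-r})^{s/(r+s)}` wherever `0 < Y < ∞` or `w = 0`, then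
Mathlib's two-exponent Hölder inequality `ENNReal.lintegral_mul_norm_pow_le`, and cancellation of
the finite non-zero factor `(∫⁻ w)^{s/(r+s)}`.  Standard (Hardy–Littlewood–Pólya, *Inequalities*,
2nd ed., CUP 1952, §2.9 Thm 16; Lyapunov 1901); no single source is followed. [folklore]
-/

namespace Literature.MeasureTheory.Integral

open _root_.MeasureTheory _root_.Filter
open scoped ENNReal

variable {α : Type*} [MeasurableSpace α] {μ : Measure α}

/-- **Weighted Hölder step behind Lyapunov's inequality for a negative and a positive moment.**
For a.e.-measurable `w, Y : α → ℝ≥0∞` with `Y < ∞` a.e., `0 < r`, `0 < s` and a finite negative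
moment `∫⁻ w Y^{-r} dμ < ∞`:
`∫⁻ w dμ ≤ (∫⁻ w Y^s dμ)^{r/(r+s)} · (∫⁻ w Y^{-r} dμ)^{s/(r+s)}`. [folklore] -/
theorem lintegral_le_rpow_lintegral_mul_rpow_lintegral {w Y : α → ℝ≥0∞} (hw : AEMeasurable w μ)
    (hY : AEMeasurable Y μ) (hYtop : ∀ᵐ x ∂μ, Y x ≠ ∞) {r s : ℝ} (hr : 0 < r) (hs : 0 < s)
    (hfin : ∫⁻ x, w x * Y x ^ (-r) ∂μ ≠ ∞) :
    ∫⁻ x, w x ∂μ ≤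
      (∫⁻ x, w x * Y x ^ s ∂μ) ^ (r / (r + s)) * (∫⁻ x, w x * Y x ^ (-r) ∂μ) ^ (s / (r + s)) := by
  have hrs : 0 < r + s := add_pos hr hs
  set p : ℝ := r / (r + s) with hp
  set q : ℝ := s / (r + s) with hq
  have hp0 : 0 < p := div_pos hr hrs
  have hq0 : 0 < q := div_pos hs hrs
  have hpq : p + q = 1 := by rw [hp, hq, ← add_div, div_self hrs.ne']
  have hexp : s * p + -r * q = 0 := by
    rw [hp, hq, mul_div_assoc', mul_div_assoc', ← add_div, neg_mul, mul_comm r s,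
      add_neg_cancel, zero_div]
  -- a.e. the weight vanishes where `Y = 0` (there `Y ^ (-r) = ⊤`), so `w = (w Y^s)^p (w Y^{-r})^q`
  have hae : ∀ᵐ x ∂μ, w x * Y x ^ (-r) < ∞ := ae_lt_top' (hw.mul (hY.pow_const _)) hfin
  have hpt : ∀ᵐ x ∂μ, w x = (w x * Y x ^ s) ^ p * (w x * Y x ^ (-r)) ^ q := by
    filter_upwards [hae, hYtop] with x hx hxT
    rcases eq_or_ne (Y x) 0 with h0 | h0
    · rw [h0, ENNReal.zero_rpow_of_neg (neg_lt_zero.2 hr)] at hx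
      have hw0 : w x = 0 := by
        by_contra hne
        rw [ENNReal.mul_top hne] at hx
        exact lt_irrefl _ hx
      rw [hw0, zero_mul, zero_mul, ENNReal.zero_rpow_of_pos hp0, zero_mul]
    · rw [ENNReal.mul_rpow_of_nonneg _ _ hp0.le, ENNReal.mul_rpow_of_nonneg _ _ hq0.le,
        ← ENNReal.rpow_mul, ← ENNReal.rpow_mul, mul_mul_mul_comm,
        ← ENNReal.rpow_add_of_nonneg _ _ hp0.le hq0.le, ← ENNReal.rpow_add _ _ h0 hxT, hpq, hexp,
        ENNReal.rpow_one, ENNReal.rpow_zero, mul_one]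
  calc ∫⁻ x, w x ∂μ = ∫⁻ x, (w x * Y x ^ s) ^ p * (w x * Y x ^ (-r)) ^ q ∂μ := lintegral_congr_ae hpt
    _ ≤ (∫⁻ x, w x * Y x ^ s ∂μ) ^ p * (∫⁻ x, w x * Y x ^ (-r) ∂μ) ^ q :=
        ENNReal.lintegral_mul_norm_pow_le (f := fun x => w x * Y x ^ s)
          (g := fun x => w x * Y x ^ (-r)) (hw.mul (hY.pow_const _)) (hw.mul (hY.pow_const _))
          hp0.le hq0.le hpq

/-- **Lyapunov's inequality, negative-to-positive moment, weighted `ℝ≥0∞` form.** For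
a.e.-measurable `w, Y : α → ℝ≥0∞` with `Y < ∞` a.e., `0 < r`, `0 < s`, `B < ∞` and a weight of finite
non-zero mass `0 < ∫⁻ w dμ < ∞`: if `∫⁻ w Y^{-r} dμ ≤ B ∫⁻ w dμ` then `∫⁻ w dμ ≤ B^{s/r} ∫⁻ w Y^s dμ`
(i.e. `E_w[Y^s] ≥ E_w[Y^{-r}]^{-s/r}`; Hardy–Littlewood–Pólya Thm 16). [folklore] -/
theorem lintegral_le_rpow_mul_lintegral_of_lintegral_rpow_neg_le {w Y : α → ℝ≥0∞}
    (hw : AEMeasurable w μ) (hY : AEMeasurable Y μ) (hYtop : ∀ᵐ x ∂μ, Y x ≠ ∞) {r s : ℝ}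
    (hr : 0 < r) (hs : 0 < s) {B : ℝ≥0∞} (hBtop : B ≠ ∞)
    (hB : ∫⁻ x, w x * Y x ^ (-r) ∂μ ≤ B * ∫⁻ x, w x ∂μ) (hW0 : ∫⁻ x, w x ∂μ ≠ 0)
    (hWtop : ∫⁻ x, w x ∂μ ≠ ∞) :
    ∫⁻ x, w x ∂μ ≤ B ^ (s / r) * ∫⁻ x, w x * Y x ^ s ∂μ := by
  have hrs : 0 < r + s := add_pos hr hs
  set p : ℝ := r / (r + s) with hp
  set q : ℝ := s / (r + s) with hq
  have hp0 : 0 < p := div_pos hr hrs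
  have hq0 : 0 < q := div_pos hs hrs
  have hpq : p + q = 1 := by rw [hp, hq, ← add_div, div_self hrs.ne']
  have hqp : q * p⁻¹ = s / r := by
    rw [hp, hq, inv_div, div_mul_div_comm, mul_comm s (r + s), mul_div_mul_left _ _ hrs.ne']
  set W := ∫⁻ x, w x ∂μ with hW
  set Ip := ∫⁻ x, w x * Y x ^ s ∂μ with hIp
  have hfin : ∫⁻ x, w x * Y x ^ (-r) ∂μ ≠ ∞ :=
    ne_top_of_le_ne_top (ENNReal.mul_ne_top hBtop hWtop) hB
  -- Hölder: `W ≤ Ip^p (B W)^q = Ip^p B^q W^q`, then cancel `W^q`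
  have h1 : W ^ p * W ^ q ≤ Ip ^ p * B ^ q * W ^ q :=
    calc W ^ p * W ^ q = W := by rw [← ENNReal.rpow_add_of_nonneg _ _ hp0.le hq0.le, hpq, ENNReal.rpow_one]
      _ ≤ Ip ^ p * (∫⁻ x, w x * Y x ^ (-r) ∂μ) ^ q :=
          lintegral_le_rpow_lintegral_mul_rpow_lintegral hw hY hYtop hr hs hfin
      _ ≤ Ip ^ p * (B * W) ^ q := mul_le_mul_right (ENNReal.rpow_le_rpow hB hq0.le) _
      _ = Ip ^ p * B ^ q * W ^ q := by rw [ENNReal.mul_rpow_of_nonneg _ _ hq0.le, mul_assoc]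
  have hWq0 : W ^ q ≠ 0 := (ENNReal.rpow_pos (pos_iff_ne_zero.2 hW0) hWtop).ne'
  have hWqtop : W ^ q ≠ ∞ := ENNReal.rpow_ne_top_of_nonneg hq0.le hWtop
  have h2 : W ^ p ≤ Ip ^ p * B ^ q := (ENNReal.mul_le_mul_iff_left hWq0 hWqtop).1 h1
  -- undo the power `p`
  calc W ≤ (Ip ^ p * B ^ q) ^ p⁻¹ := (ENNReal.le_rpow_inv_iff hp0).2 h2
    _ = B ^ (s / r) * Ip := by
        rw [ENNReal.mul_rpow_of_nonneg _ _ (inv_nonneg.2 hp0.le), ← ENNReal.rpow_mul,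
          ← ENNReal.rpow_mul, mul_inv_cancel₀ hp0.ne', ENNReal.rpow_one, hqp, mul_comm]

/-- **Lyapunov's inequality, negative-to-positive moment, real weighted form.** Let `w, X ≥ 0` be
real a.e.-measurable functions with `w` and `w · X^s` integrable, `0 < r`, `0 < s`, `0 < B`.  If the
weighted negative moment obeys `∫⁻ ofReal w · (ofReal X)^{-r} dμ ≤ ofReal B · ∫⁻ ofReal w dμ` (in
`ℝ≥0∞`, where `(ofReal 0)^{-r} = ⊤`), then `B^{-s/r} ∫ w dμ ≤ ∫ w X^s dμ` — the normalised
fractional moment `E_w[X^s]` is at least `B^{-s/r}`. [folklore] -/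
theorem rpow_neg_mul_integral_le_integral_mul_rpow {w X : α → ℝ} (hw : AEMeasurable w μ)
    (hX : AEMeasurable X μ) (hw0 : ∀ x, 0 ≤ w x) (hX0 : ∀ x, 0 ≤ X x) (hwi : Integrable w μ)
    {r s B : ℝ} (hr : 0 < r) (hs : 0 < s) (hB : 0 < B)
    (hwXi : Integrable (fun x => w x * X x ^ s) μ)
    (h : ∫⁻ x, ENNReal.ofReal (w x) * ENNReal.ofReal (X x) ^ (-r) ∂μ ≤
      ENNReal.ofReal B * ∫⁻ x, ENNReal.ofReal (w x) ∂μ) :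
    B ^ (-(s / r)) * ∫ x, w x ∂μ ≤ ∫ x, w x * X x ^ s ∂μ := by
  have hI0 : 0 ≤ ∫ x, w x * X x ^ s ∂μ :=
    integral_nonneg fun x => mul_nonneg (hw0 x) (Real.rpow_nonneg (hX0 x) _)
  rcases (integral_nonneg hw0 : 0 ≤ ∫ x, w x ∂μ).eq_or_lt with hZ | hZ
  · rw [← hZ, mul_zero]; exact hI0
  -- the `ℝ≥0∞` form
  have hW : ENNReal.ofReal (∫ x, w x ∂μ) = ∫⁻ x, ENNReal.ofReal (w x) ∂μ :=
    ofReal_integral_eq_lintegral_ofReal hwi (ae_of_all _ hw0)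
  have hIp : ENNReal.ofReal (∫ x, w x * X x ^ s ∂μ) =
      ∫⁻ x, ENNReal.ofReal (w x) * ENNReal.ofReal (X x) ^ s ∂μ := by
    rw [ofReal_integral_eq_lintegral_ofReal hwXi
      (ae_of_all _ fun x => mul_nonneg (hw0 x) (Real.rpow_nonneg (hX0 x) _))]
    exact lintegral_congr fun x => by
      rw [ENNReal.ofReal_mul (hw0 x), ENNReal.ofReal_rpow_of_nonneg (hX0 x) hs.le]
  have hle := lintegral_le_rpow_mul_lintegral_of_lintegral_rpow_neg_le (μ := μ)
    hw.ennreal_ofReal hX.ennreal_ofReal (ae_of_all _ fun x => ENNReal.ofReal_ne_top) hr hs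
    ENNReal.ofReal_ne_top h (by rw [← hW]; exact (ENNReal.ofReal_pos.2 hZ).ne')
    (by rw [← hW]; exact ENNReal.ofReal_ne_top)
  rw [← hW, ← hIp, ENNReal.ofReal_rpow_of_pos hB, ← ENNReal.ofReal_mul (Real.rpow_nonneg hB.le _),
    ENNReal.ofReal_le_ofReal_iff (mul_nonneg (Real.rpow_nonneg hB.le _) hI0)] at hle
  -- back to `ℝ`: multiply `∫ w ≤ B^{s/r} ∫ w X^s` by `B^{-s/r}`
  calc B ^ (-(s / r)) * ∫ x, w x ∂μ ≤ B ^ (-(s / r)) * (B ^ (s / r) * ∫ x, w x * X x ^ s ∂μ) :=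
        mul_le_mul_of_nonneg_left hle (Real.rpow_nonneg hB.le _)
    _ = ∫ x, w x * X x ^ s ∂μ := by
        rw [← mul_assoc, Real.rpow_neg hB.le, inv_mul_cancel₀ (Real.rpow_pos_of_pos hB _).ne', one_mul]

end Literature.MeasureTheory.Integral
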